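import Literature.Computability.Cryptography.PolyTimeComputableReals
import Literature.Computability.Complexity.NatSqrtFP
import HarnessLib

/-!
# Polynomial-time computable reals: inverses and square roots (Ko 1991, §2)

Continues `PolyTimeComputableReals.lean` (the ring operations). Here: the class `P_ℝ` of
polynomial-time computable reals (`IsPolyTimeComputableReal`, `QuantumTuringMachine.lean`; Ko 1991,
Def. 2.1) is closed under inverses (`IsPolyTimeComputableReal.inv`, `.div`) and under square roots
(`IsPolyTimeComputableReal.sqrt`) — so it contains every real number obtained from the rationals by
field operations and square roots, in particular the entries of the Clifford+`T` and
Aharonov–Jones–Landau gates (`QuantumComplexity/JonesGateEntriesPolyTime.lean`). Both are stated for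
Mathlib's total operations (`0⁻¹ = 0`, `√x = 0` for `x < 0`), without side conditions.

* Inverse (Ko 1991, §2.2): for `x ≠ 0` pick `k` with `2^{-k} ≤ |x|`; with `m = n + 2k + 4` and
  `a = f m` one has `|a/2^m| ≥ 2^{-k-1}`, `|1/x − 2^m/a| ≤ 2^{-m} 2^{2k+1} = 2^{-n-3}`, and the integer
  `⌊2^{m+n+2}/a⌋` (the bricks `zedivF`, `powFn 1`) is within `1`; the rounding lemma
  `IsPolyTimeComputableReal.of_approx` finishes.
* Square root: for `x ≥ 0`, with `m = 2n + 4`, `N = |f m|`: `|x − N/4^{n+2}| ≤ 4^{-(n+2)}`, hence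
  `|√x − √N/2^{n+2}| ≤ 2^{-(n+2)}` (`|√u − √v| ≤ √|u − v|`), and `⌊√N⌋` (the `FP` integer square root
  `Brick.natSqrt_mem_FP` of `Complexity/NatSqrtFP.lean`) is within `1` of `√N`.

Also the complex layer (Bernstein–Vazirani 1997, Def. 3.2: `C̃` = real and imaginary part in `P_ℝ`):
`IsPolyTimeComputableComplex` is closed under `+`, `-`, `·`, conjugation, and contains `↑r` for
`r ∈ P_ℝ`.

## References

* K.-I. Ko, *Complexity Theory of Real Functions*, Birkhäuser 1991, §2.1–§2.2 (`P_ℝ` is a real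
  closed field; in particular closed under division and square roots) [Ko1991].
* E. Bernstein, U. Vazirani, *Quantum complexity theory*, SIAM J. Comput. 26 (1997), Def. 3.2, §6
  [BernsteinVazirani1997].
* S. Arora, B. Barak, *Computational Complexity: A Modern Approach*, CUP 2009, §1.3 [AroraBarak2009].
-/

namespace Literature.Computability.Cryptography

open _root_.Computability Literature.Computability.Complexity
  Literature.Computability.Complexity.Brick Literature.Computability.Complexity.TimeConstructible

/-! ### Two more polynomial-time names -/

/-- `|1ⁿ| = n` (private copy of a folklore helper). [folklore] -/
private theorem length_unaryEncodeNat_ptcs (n : ℕ) : (unaryEncodeNat n).length = n := by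
  rw [OracleCompose.unaryEncodeNat_eq_replicate, List.length_replicate]

/-- `n ↦ 2^{c + 2n}` is a polynomial-time name (the power brick `powFn 1` on `1ᶜ 1ⁿ 1ⁿ`).
[cite: AroraBarak2009, §1.3] -/
theorem polyTimeComputable_two_pow_unary (c : ℕ) :
    PolyTimeComputable unaryEncodeNat encodingIntBool.encode (fun n => ((2 ^ (c + 2 * n) : ℕ) : ℤ)) := by
  refine polyTimeComputable_of_nameFn
    (fanoutFn_mem_FP (const_mem_FP [false]) (comp_mem_FP (powFn_mem_FP 1)
      (append_mem_FP (const_mem_FP (ones c)) (append_mem_FP OracleCompose.id_mem_FP OracleCompose.id_mem_FP)))) fun n => ?_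
  have e : unaryEncodeNat n ++ unaryEncodeNat n = unaryEncodeNat (2 * n) := by
    rw [OracleCompose.unaryEncodeNat_eq_replicate, OracleCompose.unaryEncodeNat_eq_replicate, two_mul, List.replicate_add]
  rw [encodingIntBool_encode_natCast]
  simp only [fanoutFn_apply, Function.comp_apply, id, e, ones_append_unaryEncodeNat, powFn_unary, pow_one]

/-- `n ↦ ⌊√|f (c + 2n)|⌋` is a polynomial-time name if `f` is (the `FP` integer square root
`Brick.natSqrt_mem_FP` on the magnitude field of the code). [cite: AroraBarak2009, §1.3] -/
theorem polyTimeComputable_natSqrt_natAbs {f : ℕ → ℤ} (hf : PolyTimeComputable unaryEncodeNat encodingIntBool.encode f)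
    (c : ℕ) : PolyTimeComputable unaryEncodeNat encodingIntBool.encode
      (fun n => ((Nat.sqrt (f (c + 2 * n)).natAbs : ℕ) : ℤ)) := by
  have henc : ∀ w : ℤ, encodingIntBool.encode w = boolPair [decide (w < 0)] (encodeNat w.natAbs) := fun _ => rfl
  refine polyTimeComputable_of_nameFn
    (fanoutFn_mem_FP (const_mem_FP [false]) (comp_mem_FP natSqrt_mem_FP (comp_mem_FP sndF_mem_FP
      (IsPolyTimeComputableReal.nameFn_mem_FP (hf.unary_add_two_mul c))))) fun n => ?_
  rw [encodingIntBool_encode_natCast]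
  simp only [fanoutFn_apply, Function.comp_apply, length_unaryEncodeNat_ptcs, henc, sndF_boolPair, bitsToNat_encodeNat]

/-! ### Inverses -/

/-- Floor division is within `1` for any nonzero divisor. [folklore] -/
theorem abs_div_sub_ediv_lt' (p : ℤ) {d : ℤ} (hd : d ≠ 0) : |(p : ℝ) / d - ((p / d : ℤ) : ℝ)| < 1 := by
  rcases lt_or_gt_of_ne hd with h | h
  · have h' : 0 < -d := by omega
    have := abs_div_sub_ediv_lt p h'
    rwa [Int.ediv_neg, Int.cast_neg, Int.cast_neg, div_neg, sub_neg_eq_add, ← abs_neg, neg_add, neg_neg,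
      ← sub_eq_add_neg] at this
  · exact abs_div_sub_ediv_lt p h

/-- **`P_ℝ` is closed under inverses** (`0⁻¹ = 0`). [cite: Ko1991, §2.2] -/
theorem IsPolyTimeComputableReal.inv {x : ℝ} (hx : IsPolyTimeComputableReal x) : IsPolyTimeComputableReal x⁻¹ := by
  by_cases hx0 : x = 0
  · rw [hx0, inv_zero]; exact isPolyTimeComputableReal_zero
  obtain ⟨f, hf, hb⟩ := hx
  obtain ⟨k, hk⟩ : ∃ k : ℕ, (1 / 2 : ℝ) ^ k ≤ |x| := by
    obtain ⟨k, hk⟩ := exists_pow_lt_of_lt_one (abs_pos.2 hx0) (by norm_num : (1 / 2 : ℝ) < 1)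
    exact ⟨k, hk.le⟩
  refine IsPolyTimeComputableReal.of_approx
    (fun n => ((2 ^ (2 * k + 6 + 2 * n) : ℕ) : ℤ) / f (2 * k + 4 + n)) ?_ fun n => ?_
  · refine polyTimeComputable_of_nameFn
      (comp_mem_FP signMagOfZF_mem_FP (comp_mem_FP zedivF_mem_FP (fanoutFn_mem_FP
        (comp_mem_FP ofSMFn_mem_FP (IsPolyTimeComputableReal.nameFn_mem_FP (polyTimeComputable_two_pow_unary (2 * k + 6))))
        (comp_mem_FP ofSMFn_mem_FP (IsPolyTimeComputableReal.nameFn_mem_FP (hf.unary_add_left (2 * k + 4))))))) fun n => ?_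
    simp only [Function.comp_apply, fanoutFn_apply, length_unaryEncodeNat_ptcs, ofSMFn_encodingIntBool, zedivF_dpEnc,
      signMagOfZF_dpEnc']
  · -- notation
    set m := 2 * k + 4 + n with hm
    set a : ℤ := f m with ha
    have h2m : (0 : ℝ) < 2 ^ m := pow_pos (by norm_num) m
    have hxm := hb m
    rw [← ha] at hxm
    -- `|a / 2^m| ≥ 2^{-k-1}`, in particular `a ≠ 0`
    have hpow : (1 / 2 : ℝ) ^ m ≤ (1 / 2 : ℝ) ^ (k + 1) := pow_le_pow_of_le_one (by norm_num) (by norm_num) (by omega)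
    have hge : (1 / 2 : ℝ) ^ (k + 1) ≤ |(a : ℝ) / 2 ^ m| := by
      have h1 : |x| ≤ |x - (a : ℝ) / 2 ^ m| + |(a : ℝ) / 2 ^ m| := by
        have := abs_add_le (x - (a : ℝ) / 2 ^ m) ((a : ℝ) / 2 ^ m)
        rwa [sub_add_cancel] at this
      have h2 : (1 / 2 : ℝ) ^ k = 2 * (1 / 2 : ℝ) ^ (k + 1) := by rw [pow_succ]; ring
      linarith
    have hapos : 0 < |(a : ℝ) / 2 ^ m| := lt_of_lt_of_le (by positivity) hge
    have ha0 : a ≠ 0 := by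
      rintro h0
      rw [h0, Int.cast_zero, zero_div, abs_zero] at hapos
      exact lt_irrefl _ hapos
    have ha0R : (a : ℝ) ≠ 0 := by exact_mod_cast ha0
    -- the analytic error `|1/x - 2^m/a| ≤ 2^{-(n+3)}`
    have herr : |x⁻¹ - 2 ^ m / (a : ℝ)| ≤ (1 / 2 : ℝ) ^ (n + 3) := by
      have e : x⁻¹ - 2 ^ m / (a : ℝ) = ((a : ℝ) / 2 ^ m - x) / (x * ((a : ℝ) / 2 ^ m)) := by
        field_simp
      rw [e, abs_div, abs_mul, abs_sub_comm, div_le_iff₀ (mul_pos (abs_pos.2 hx0) hapos)]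
      have e2 : (1 / 2 : ℝ) ^ m = (1 / 2 : ℝ) ^ (n + 3) * ((1 / 2 : ℝ) ^ k * (1 / 2 : ℝ) ^ (k + 1)) := by
        rw [← pow_add, ← pow_add]; congr 1; omega
      calc |x - (a : ℝ) / 2 ^ m| ≤ (1 / 2 : ℝ) ^ m := hxm
        _ = (1 / 2 : ℝ) ^ (n + 3) * ((1 / 2 : ℝ) ^ k * (1 / 2 : ℝ) ^ (k + 1)) := e2
        _ ≤ (1 / 2 : ℝ) ^ (n + 3) * (|x| * |(a : ℝ) / 2 ^ m|) :=
          mul_le_mul_of_nonneg_left (mul_le_mul hk hge (by positivity) (abs_nonneg _)) (by positivity)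
    -- the rounding error of the floor division
    have hfl := abs_div_sub_ediv_lt' (((2 ^ (2 * k + 6 + 2 * n) : ℕ) : ℤ)) ha0
    have h2n : (0 : ℝ) < 2 ^ (n + 2) := pow_pos (by norm_num) _
    have e : x⁻¹ - ((((2 ^ (2 * k + 6 + 2 * n) : ℕ) : ℤ) / a : ℤ) : ℝ) / 2 ^ (n + 2) =
        (x⁻¹ - 2 ^ m / (a : ℝ)) +
          (((((2 ^ (2 * k + 6 + 2 * n) : ℕ) : ℤ) : ℝ)) / (a : ℝ) - ((((2 ^ (2 * k + 6 + 2 * n) : ℕ) : ℤ) / a : ℤ) : ℝ)) /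
            2 ^ (n + 2) := by
      have ep : ((((2 ^ (2 * k + 6 + 2 * n) : ℕ) : ℤ) : ℝ)) = 2 ^ m * 2 ^ (n + 2) := by
        push_cast
        rw [← pow_add]; congr 1; omega
      rw [ep]
      field_simp
      ring
    rw [e]
    refine (abs_add_le _ _).trans ?_
    rw [abs_div _ ((2 : ℝ) ^ (n + 2)), abs_of_pos h2n]
    have h3 : |((((2 ^ (2 * k + 6 + 2 * n) : ℕ) : ℤ) : ℝ)) / (a : ℝ) - ((((2 ^ (2 * k + 6 + 2 * n) : ℕ) : ℤ) / a : ℤ) : ℝ)| /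
        2 ^ (n + 2) ≤ 1 / 2 ^ (n + 2) := div_le_div_of_nonneg_right hfl.le h2n.le
    have e3 : (1 / 2 : ℝ) ^ (n + 3) + 1 / 2 ^ (n + 2) ≤ (1 / 2 : ℝ) ^ (n + 1) := by
      have e4 : (1 / 2 : ℝ) ^ (n + 3) + 1 / 2 ^ (n + 2) = 1 / 2 ^ (n + 1) * (3 / 4) := by
        rw [one_div_pow, pow_succ _ (n + 2), pow_succ _ (n + 1)]; ring
      have e5 : (1 / 2 : ℝ) ^ (n + 1) = 1 / 2 ^ (n + 1) := one_div_pow _ _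
      rw [e4, e5]
      have : 0 < 1 / (2 : ℝ) ^ (n + 1) := by positivity
      linarith
    exact (add_le_add herr h3).trans e3

/-- **`P_ℝ` is closed under division** (`x / 0 = 0`). [cite: Ko1991, §2.2] -/
theorem IsPolyTimeComputableReal.div {x y : ℝ} (hx : IsPolyTimeComputableReal x) (hy : IsPolyTimeComputableReal y) :
    IsPolyTimeComputableReal (x / y) := by
  rw [div_eq_mul_inv]; exact hx.mul hy.inv

/-- Rational numbers (as real numerals `p / q`) are in `P_ℝ`. [cite: Ko1991, §2.1] -/
theorem IsPolyTimeComputableReal.ratCast' (q : ℚ) : IsPolyTimeComputableReal (q : ℝ) :=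
  IsPolyTimeComputableReal.ratCast_holds q

/-! ### Square roots -/

/-- `|√u - √v| ≤ √|u - v|` for `u, v ≥ 0`. [folklore] -/
theorem abs_sqrt_sub_sqrt_le {u v : ℝ} (hu : 0 ≤ u) (hv : 0 ≤ v) : |Real.sqrt u - Real.sqrt v| ≤ Real.sqrt |u - v| := by
  -- by symmetry assume `v ≤ u`
  wlog h : v ≤ u generalizing u v
  · rw [abs_sub_comm, abs_sub_comm u v]
    exact this hv hu (le_of_not_ge h)
  rw [abs_of_nonneg (sub_nonneg.2 (Real.sqrt_le_sqrt h)), abs_of_nonneg (sub_nonneg.2 h), sub_le_iff_le_add]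
  have key : u ≤ (Real.sqrt (u - v) + Real.sqrt v) ^ 2 := by
    rw [add_sq, Real.sq_sqrt (sub_nonneg.2 h), Real.sq_sqrt hv]
    have : 0 ≤ 2 * Real.sqrt (u - v) * Real.sqrt v := by positivity
    linarith
  calc Real.sqrt u ≤ Real.sqrt ((Real.sqrt (u - v) + Real.sqrt v) ^ 2) := Real.sqrt_le_sqrt key
    _ = Real.sqrt (u - v) + Real.sqrt v := Real.sqrt_sq (by positivity)

/-- **`P_ℝ` is closed under square roots** (`√x = 0` for `x < 0`). [cite: Ko1991, §2.2] -/
theorem IsPolyTimeComputableReal.sqrt {x : ℝ} (hx : IsPolyTimeComputableReal x) : IsPolyTimeComputableReal (Real.sqrt x) := by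
  by_cases hx0 : x < 0
  · rw [Real.sqrt_eq_zero'.2 hx0.le]; exact isPolyTimeComputableReal_zero
  rw [not_lt] at hx0
  obtain ⟨f, hf, hb⟩ := hx
  refine IsPolyTimeComputableReal.of_approx (fun n => ((Nat.sqrt (f (4 + 2 * n)).natAbs : ℕ) : ℤ))
    (polyTimeComputable_natSqrt_natAbs hf 4) fun n => ?_
  set m := 4 + 2 * n with hm
  set a : ℤ := f m with ha
  set N : ℕ := a.natAbs with hN
  have h2m : (0 : ℝ) < 2 ^ m := pow_pos (by norm_num) m
  have h2n : (0 : ℝ) < 2 ^ (n + 2) := pow_pos (by norm_num) _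
  have hmm : (2 : ℝ) ^ m = 2 ^ (n + 2) * 2 ^ (n + 2) := by rw [← pow_add]; congr 1; omega
  -- `|x - N/2^m| ≤ 2^{-m}` (replacing `a` by `|a|` only helps, as `x ≥ 0`)
  have h1 : |x - (N : ℝ) / 2 ^ m| ≤ (1 / 2 : ℝ) ^ m := by
    have hxm := hb m
    rw [← ha] at hxm
    have eN : (N : ℝ) / 2 ^ m = |(a : ℝ) / 2 ^ m| := by
      rw [hN, Nat.cast_natAbs, abs_div, abs_of_pos h2m, Int.cast_abs]
    rw [eN]
    have := abs_abs_sub_abs_le_abs_sub x ((a : ℝ) / 2 ^ m)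
    rw [abs_of_nonneg hx0] at this
    exact this.trans hxm
  -- `|√x - √N / 2^{n+2}| ≤ 2^{-(n+2)}`
  have h2 : |Real.sqrt x - Real.sqrt N / 2 ^ (n + 2)| ≤ (1 / 2 : ℝ) ^ (n + 2) := by
    have e1 : Real.sqrt N / 2 ^ (n + 2) = Real.sqrt ((N : ℝ) / 2 ^ m) := by
      rw [Real.sqrt_div' _ h2m.le, hmm, Real.sqrt_mul_self h2n.le]
    rw [e1]
    refine (abs_sqrt_sub_sqrt_le hx0 (by positivity)).trans ?_
    calc Real.sqrt |x - (N : ℝ) / 2 ^ m| ≤ Real.sqrt ((1 / 2 : ℝ) ^ m) := Real.sqrt_le_sqrt h1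
      _ = (1 / 2 : ℝ) ^ (n + 2) := by
        rw [hm, show 4 + 2 * n = (n + 2) + (n + 2) by omega, pow_add, Real.sqrt_mul_self (by positivity)]
  -- `|√N - ⌊√N⌋| < 1` (`⌊√N⌋ ≤ √N < ⌊√N⌋ + 1`)
  have h3 : |Real.sqrt N - Nat.sqrt N| < 1 := by
    have := Real.nat_sqrt_le_real_sqrt (a := N)
    have := Real.real_sqrt_lt_nat_sqrt_succ (a := N)
    rw [abs_lt]
    constructor <;> linarith
  have e : Real.sqrt x - ((((Nat.sqrt N : ℕ) : ℤ) : ℝ)) / 2 ^ (n + 2) =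
      (Real.sqrt x - Real.sqrt N / 2 ^ (n + 2)) + (Real.sqrt N - Nat.sqrt N) / 2 ^ (n + 2) := by
    push_cast; ring
  rw [e]
  refine (abs_add_le _ _).trans ?_
  rw [abs_div _ ((2 : ℝ) ^ (n + 2)), abs_of_pos h2n]
  have h4 : |Real.sqrt N - Nat.sqrt N| / 2 ^ (n + 2) ≤ 1 / 2 ^ (n + 2) := div_le_div_of_nonneg_right h3.le h2n.le
  have e2 : (1 / 2 : ℝ) ^ (n + 2) + 1 / 2 ^ (n + 2) = (1 / 2 : ℝ) ^ (n + 1) := by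
    have h := pow_succ (1 / 2 : ℝ) (n + 1)
    rw [show n + 1 + 1 = n + 2 from rfl] at h
    rw [← one_div_pow, h]
    ring
  calc _ ≤ (1 / 2 : ℝ) ^ (n + 2) + 1 / 2 ^ (n + 2) := add_le_add h2 h4
    _ = _ := e2

/-! ### The complex layer -/

/-- A complex number with polynomial-time real and imaginary parts is in `C̃`. [cite: BernsteinVazirani1997, Def. 3.2] -/
theorem IsPolyTimeComputableComplex.of_re_im {z : ℂ} (h₁ : IsPolyTimeComputableReal z.re) (h₂ : IsPolyTimeComputableReal z.im) :
    IsPolyTimeComputableComplex z := ⟨h₁, h₂⟩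

/-- Real numbers of `P_ℝ` are in `C̃`. [cite: BernsteinVazirani1997, Def. 3.2] -/
theorem IsPolyTimeComputableComplex.ofReal {r : ℝ} (h : IsPolyTimeComputableReal r) : IsPolyTimeComputableComplex (r : ℂ) :=
  ⟨by simpa using h, by simpa using isPolyTimeComputableReal_zero⟩

/-- `C̃` is closed under addition. [cite: BernsteinVazirani1997, Def. 3.2] -/
theorem IsPolyTimeComputableComplex.add {z w : ℂ} (hz : IsPolyTimeComputableComplex z) (hw : IsPolyTimeComputableComplex w) :
    IsPolyTimeComputableComplex (z + w) :=
  ⟨by simpa using hz.1.add hw.1, by simpa using hz.2.add hw.2⟩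

/-- `C̃` is closed under subtraction. [cite: BernsteinVazirani1997, Def. 3.2] -/
theorem IsPolyTimeComputableComplex.sub {z w : ℂ} (hz : IsPolyTimeComputableComplex z) (hw : IsPolyTimeComputableComplex w) :
    IsPolyTimeComputableComplex (z - w) :=
  ⟨by simpa using hz.1.sub hw.1, by simpa using hz.2.sub hw.2⟩

/-- `C̃` is closed under multiplication. [cite: BernsteinVazirani1997, Def. 3.2] -/
theorem IsPolyTimeComputableComplex.mul {z w : ℂ} (hz : IsPolyTimeComputableComplex z) (hw : IsPolyTimeComputableComplex w) :
    IsPolyTimeComputableComplex (z * w) :=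
  ⟨by simpa using (hz.1.mul hw.1).sub (hz.2.mul hw.2), by simpa using (hz.1.mul hw.2).add (hz.2.mul hw.1)⟩

/-- `C̃` is closed under complex conjugation. [cite: BernsteinVazirani1997, Def. 3.2] -/
theorem IsPolyTimeComputableComplex.conj {z : ℂ} (hz : IsPolyTimeComputableComplex z) :
    IsPolyTimeComputableComplex (starRingEnd ℂ z) :=
  ⟨by simpa using hz.1, by simpa using hz.2.neg⟩

/-- `C̃` is closed under `if-then-else`. [folklore] -/
theorem IsPolyTimeComputableComplex.ite {p : Prop} [Decidable p] {z w : ℂ} (hz : IsPolyTimeComputableComplex z)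
    (hw : IsPolyTimeComputableComplex w) : IsPolyTimeComputableComplex (if p then z else w) := by
  split_ifs
  · exact hz
  · exact hw

/-- `cos θ + i sin θ = e^{iθ} ∈ C̃` when `cos θ, sin θ ∈ P_ℝ`. [cite: BernsteinVazirani1997, Def. 3.2] -/
theorem IsPolyTimeComputableComplex.exp_mul_I {θ : ℝ} (hc : IsPolyTimeComputableReal (Real.cos θ))
    (hs : IsPolyTimeComputableReal (Real.sin θ)) : IsPolyTimeComputableComplex (Complex.exp (θ * Complex.I)) :=
  ⟨by rw [Complex.exp_ofReal_mul_I_re]; exact hc, by rw [Complex.exp_ofReal_mul_I_im]; exact hs⟩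

end Literature.Computability.Cryptography
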